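import Summits.HubbardSuperconductivity.HubbardSuperconductivity.Theorems.BalabanIRBirGappedPhaseReductionRLogic
import HarnessLib

/-!
# Crux strategist sketch — `BirGappedPhaseReductionR` (stmt-HubbardSuperconductivity-14846), 2026-08-17

STRATEGY-CENSUS §5 (Decomposition), attempt D2: the honest two-piece cut of the INTENDED content of
crux 4R, typed as a ONE-PARAMETER FAMILY of splits indexed by the Defs-layer predicate `SF`
("small-field quasi-local analytic action in format 𝔉 with budget B") that Lean does not have yet.

* `CoerciveWeight K c₀ ρ`     — the TYPEABLE hypotheses W1–W4 of the weight-format engine class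
                                 (symmetries (U1)(T)(R)(P), normalisation, global coercivity of the
                                 modulus: the `fockCoercivity`/Hölder shape, one small factor per
                                 misaligned space-time bond).
* `EnginePrime SF`            — child C1 = 14845′: slice order ≥ 1/2 and Z ≠ 0 for every weight in
                                 the class `CoerciveWeight ∧ SF`, K ≥ K₀(B,c₀), even L₀ ≤ L ≤ M.
* `MembershipTransferPrime SF` — child C2 = 14846′: MEMBERSHIP ∧ TRANSFER about `hubbardTorus`
                                 alone into that class (p97516's shape with the finite table replaced
                                 by a weight `ρ` on a BLOCK torus of side `L'`, decoupled from the
                                 physical side `L`).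
* `reductionR_of_pair`        — C1 → C2 → 4R, sorry-free, for EVERY `SF`; `h2R` and `h3` are
                                 discarded: the pair REPLACES the typed engine, it does not consume it.
* `enginePrime_top_iff`       — calibration of the family at the endpoint `SF = ⊤` is recorded only
                                 informally (coercivity alone does not control the phase of ρ).

Nothing here is filed; the census explains why (C1 ⊋ THE BET = stmt-14845; `SF` undesigned).
-/

noncomputable section

set_option linter.dupNamespace false

namespace Summit.HubbardSuperconductivity.HubbardSuperconductivity.Cruxes.BirGappedPhaseReductionR.Strategist

open scoped BigOperators ComplexConjugate
open MeasureTheory Complex Filter Matrix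
open Literature.Probability.LatticeModels Literature.MathematicalPhysics.QuantumLattice
open Summit.HubbardSuperconductivity.HubbardSuperconductivity.Theses.BalabanIR
open Summit.HubbardSuperconductivity.HubbardSuperconductivity.Theorems

/-- Sites of the anisotropic (2+1)D torus with `L'` BLOCKS per spatial side and `M` time slices. -/
abbrev Site (L' M : ℕ) := TorusSite 2 L' × ZMod M

variable {L' M : ℕ} [NeZero L'] [NeZero M]

/-- Nearest-neighbour misalignment energy of a phase configuration: spatial bonds in the two
lattice directions plus the temporal bond, each counted once per site. -/
def misalign (θ : Site L' M → ℝ) : ℝ :=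
  ∑ s : Site L' M,
    ((1 - Real.cos (θ (s.1 + ![1, 0], s.2) - θ s)) + (1 - Real.cos (θ (s.1 + ![0, 1], s.2) - θ s)) +
      (1 - Real.cos (θ (s.1, s.2 + 1) - θ s)))

/-- Equal-time slice order `|L'⁻² Σ_x e^{iθ(x,0)}|²` (the engine's observable). -/
def sliceOrder (L' M : ℕ) [NeZero L'] [NeZero M] (θ : Site L' M → ℝ) : ℝ :=
  ‖∑ x : TorusSite 2 L', cexp (I * (θ (x, 0) : ℂ))‖ ^ 2 / (L' : ℝ) ^ 4

/-- The integration cube `[0,2π]^{Λ}`. -/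
def cube (L' M : ℕ) : Set (Site L' M → ℝ) := Set.pi Set.univ fun _ => Set.Icc (0 : ℝ) (2 * Real.pi)

/-- **W1–W4, the typeable part of the weight-format class.** A complex weight `ρ` on phase
configurations of the block torus that is continuous and `2π`-periodic (W1), U(1)- and
translation-invariant, time-reflection Hermitian (R) and inversion-even (P) (W2), normalised at the
aligned configuration (W3), and GLOBALLY COERCIVE IN MODULUS with rate `c₀ K` (W4: one factor
`e^{-c₀K(1-cos)}` per misaligned space-time bond — the shape the landed Hölder/BdG-coercivity
dictionary `fockCoercivity_of_birBdGPhaseCoercivity` delivers, up to the block-level constant). -/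
structure CoerciveWeight (K c₀ : ℝ) (L' M : ℕ) [NeZero L'] [NeZero M]
    (ρ : (Site L' M → ℝ) → ℂ) : Prop where
  cont : Continuous ρ
  periodic : ∀ (θ : Site L' M → ℝ) (s : Site L' M), ρ (Function.update θ s (θ s + 2 * Real.pi)) = ρ θ
  u1 : ∀ (θ : Site L' M → ℝ) (a : ℝ), ρ (fun s => θ s + a) = ρ θ
  transl : ∀ (θ : Site L' M → ℝ) (t : Site L' M), ρ (fun s => θ (s + t)) = ρ θ
  reflHerm : ∀ θ : Site L' M → ℝ, ρ (fun s => θ (s.1, -s.2)) = conj (ρ θ)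
  inversion : ∀ θ : Site L' M → ℝ, ρ (fun s => θ (-s.1, s.2)) = ρ θ
  norm0 : ρ (fun _ => 0) = 1
  coercive : ∀ θ : Site L' M → ℝ, ‖ρ θ‖ ≤ Real.exp (-(c₀ * K) * misalign θ)

/-- The type of the MISSING Defs-layer predicate W5 ("on every region where θ is small-field, ρ is
`exp(-K·Σ_X Φ_X(θ))` for a translation-covariant quasi-local interaction Φ analytic in a strip, with
exponentially weighted norm ≤ B, and the influence of large-field regions decays exponentially across
small-field corridors" — Balaban's step-1 (small-field action, large-field activity) format). -/
abbrev SmallFieldFormat : Type :=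
  ∀ (K B : ℝ) (L' M : ℕ) [NeZero L'] [NeZero M], ((Site L' M → ℝ) → ℂ) → Prop

/-- **Child C1 = 14845′ (engine, weight format).** For every budget `B` and coercivity rate
`c₀ > 0` there are thresholds `K₀, L₀` such that every weight of class `CoerciveWeight ∧ SF` at
stiffness `K ≥ K₀` on an even block torus `L₀ ≤ L' ≤ M` has `Z ≠ 0` and slice order `≥ 1/2`. -/
def EnginePrime (SF : SmallFieldFormat) : Prop :=
  ∀ (B c₀ : ℝ), 0 < c₀ → ∃ K₀ : ℝ, ∃ L₀ : ℕ, ∀ K : ℝ, K₀ ≤ K →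
    ∀ (L' M : ℕ) [NeZero L'] [NeZero M], L₀ ≤ L' → L' ≤ M → Even L' → Even M →
      ∀ ρ : (Site L' M → ℝ) → ℂ, CoerciveWeight K c₀ L' M ρ → SF K B L' M ρ →
        (∫ θ in cube L' M, ρ θ) ≠ 0 ∧
          (1 / 2 : ℝ) ≤ ((∫ θ in cube L' M, (sliceOrder L' M θ : ℂ) * ρ θ) / ∫ θ in cube L' M, ρ θ).re

/-- **Child C2 = 14846′ (membership ∧ transfer about `hubbardTorus` alone).** For some `δ ∈ (0,1/2)`
and class data `(B, c₀)`, EVERY pair of engine thresholds `(K₀, L₀)` admits a weak-coupling window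
`(U₁, U₂)` and `cP > 0` such that for every `U` in the window, eventually in even (physical) `L`,
frequently in `β`, there are a stiffness `K ≥ K₀`, an even BLOCK torus `L₀ ≤ L' ≤ M` and a weight `ρ`
of class `CoerciveWeight ∧ SF` — the `(N_L, S^z = 0)` pair-phase marginal of `hubbardTorus 2 L 1 U`
at inverse temperature `β` — for which the engine conclusion IMPLIES the sector thermal bound
`cP·L⁴ ≤ Re tr(P_S e^{-βH} Δ_d†Δ_d)/tr(P_S e^{-βH})`. -/
def MembershipTransferPrime (SF : SmallFieldFormat) : Prop :=
  ∃ δ ∈ Set.Ioo (0:ℝ) (1/2), ∃ (B c₀ : ℝ), 0 < c₀ ∧ ∀ (K₀ : ℝ) (L₀ : ℕ),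
    ∃ U₁ U₂ cP : ℝ, 0 < U₁ ∧ U₁ < U₂ ∧ 0 < cP ∧ ∀ U ∈ Set.Ioo U₁ U₂, ∃ L₁ : ℕ,
      ∀ (L : ℕ) [NeZero L], L₁ ≤ L → Even L →
        let N : ℕ := 2 * ⌊(1 - δ) * (L : ℝ) ^ 2 / 2⌋₊
        let H := hubbardTorus 2 L 1 U
        let S := szSector (Λ := FermionTorus 2 L) N 0
        let PS := projMatrix (S.map (Fock.toEuclidean (ι := Orb (FermionTorus 2 L)) :
          Fock (Orb (FermionTorus 2 L)) →ₗ[ℂ] EuclideanSpace ℂ (Finset (Orb (FermionTorus 2 L)))))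
        ∃ᶠ β : ℝ in atTop, ∃ K : ℝ, K₀ ≤ K ∧ ∃ (L' M : ℕ) (_ : NeZero L') (_ : NeZero M),
          L₀ ≤ L' ∧ L' ≤ M ∧ Even L' ∧ Even M ∧
          ∃ ρ : (Site L' M → ℝ) → ℂ, CoerciveWeight K c₀ L' M ρ ∧ SF K B L' M ρ ∧
            (((∫ θ in cube L' M, ρ θ) ≠ 0 ∧
                (1 / 2 : ℝ) ≤
                  ((∫ θ in cube L' M, (sliceOrder L' M θ : ℂ) * ρ θ) / ∫ θ in cube L' M, ρ θ).re) →
              cP * (L : ℝ) ^ 4 ≤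
                ((PS * gibbsWeight β H * ((pairField dWaveFormFactor L)ᴴ * pairField dWaveFormFactor L)).trace /
                    (PS * gibbsWeight β H).trace).re)

/-- **The pair closes 4R, for EVERY format predicate `SF`, discarding `h2R` and `h3`.**  This is the
kernel-checkable content of census §5 D2: the decomposition is a RESTATEMENT of the engine (C1
replaces `BirComplexStableXYR`), not a split that consumes it. -/
theorem reductionR_of_pair (SF : SmallFieldFormat) :
    EnginePrime SF → MembershipTransferPrime SF → BirGappedPhaseReductionR := by
  intro hE hM
  refine birGappedPhaseReductionR_of_engineR_imp_frequently_thermal fun _ => ?_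
  obtain ⟨δ, hδ, B, c₀, hc₀, hM⟩ := hM
  obtain ⟨K₀, L₀, hK⟩ := hE B c₀ hc₀
  obtain ⟨U₁, U₂, cP, hU₁, hU₁₂, hcP, hW⟩ := hM K₀ L₀
  refine ⟨δ, hδ, U₁, U₂, cP, hU₁, hU₁₂, hcP, fun U hU => ?_⟩
  obtain ⟨L₁, hL⟩ := hW U hU
  refine ⟨L₁, fun L _ hL₁ hLe => ?_⟩
  have key := hL L hL₁ hLe
  dsimp only at key ⊢
  refine key.mono ?_
  rintro β ⟨K, hKK, L', M, _, _, hL₀, hLM, hL'e, hMe, ρ, hρ, hSF, himp⟩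
  exact himp (hK K hKK L' M hL₀ hLM hL'e hMe ρ hρ hSF)

/-- Calibration, endpoint `SF = ⊤`: then C2's membership clause is dischargeable by any coercive
symmetric weight, and C1 claims slice order for ALL coercive symmetric weights — false in substance
(coercivity constrains the modulus only; the phase of `ρ` on the large-field configurations, which
dominate at fixed `K` as `|Λ| → ∞`, is free). So `SF` is load-bearing: the design of the Defs layer
IS the design of the engine. (Recorded as a remark; no Lean claim.) -/
theorem enginePrime_top_iff : EnginePrime (fun _ _ _ _ _ _ _ => True) ↔
    (∀ (B c₀ : ℝ), 0 < c₀ → ∃ K₀ : ℝ, ∃ L₀ : ℕ, ∀ K : ℝ, K₀ ≤ K →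
      ∀ (L' M : ℕ) [NeZero L'] [NeZero M], L₀ ≤ L' → L' ≤ M → Even L' → Even M →
        ∀ ρ : (Site L' M → ℝ) → ℂ, CoerciveWeight K c₀ L' M ρ →
          (∫ θ in cube L' M, ρ θ) ≠ 0 ∧
            (1 / 2 : ℝ) ≤ ((∫ θ in cube L' M, (sliceOrder L' M θ : ℂ) * ρ θ) / ∫ θ in cube L' M, ρ θ).re) := by
  constructor
  · intro h B c₀ hc₀
    obtain ⟨K₀, L₀, hK⟩ := h B c₀ hc₀
    exact ⟨K₀, L₀, fun K hKK L' M _ _ h1 h2 h3 h4 ρ hρ => hK K hKK L' M h1 h2 h3 h4 ρ hρ trivial⟩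
  · intro h B c₀ hc₀
    obtain ⟨K₀, L₀, hK⟩ := h B c₀ hc₀
    exact ⟨K₀, L₀, fun K hKK L' M _ _ h1 h2 h3 h4 ρ hρ _ => hK K hKK L' M h1 h2 h3 h4 ρ hρ⟩

end Summit.HubbardSuperconductivity.HubbardSuperconductivity.Cruxes.BirGappedPhaseReductionR.Strategist

end
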